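import Summits.AtomisticToContinuum.FouriersLaw.Theorems.PhononMeanFreePathDefs
import Summits.AtomisticToContinuum.FouriersLaw.Theorems.PhononMeanFreePathIncoherentBoundedFixedN

/-!
# `IncoherentChannel`, line `two-horizons-forecast-loss` — the variance channel IS the covariance of the
initial left kinetic energy with the conditional variance of the far momentum (helper 2 for `stub_varianceTransport`)

Helper file for the registered stub `stub_varianceTransport` of crux `PhononMeanFreePath.IncoherentChannel`
(item stmt-AtomisticToContinuum-11811, route `PhononMeanFreePath`, sub-problem `FouriersLaw`), vocabulary of
`PhononMeanFreePathDefs`. For the `(N+1)`-site pinned anharmonic chain `pinnedChain ω₂ lam β γ` with both baths at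
`T` (`μ₀ = gibbsMeasure (N+1) T`, `K_t = transitionKernel (N+1) T T t⁺`, the CONSTRUCTED objects) write
`v_t = fcast = K_t p_N` (mean forecast of the far momentum from the exact microstate) and
`w_t(z) = (K_t p_N²)(z) - v_t(z)² = Var(p_N(t) | z)` (its forecast VARIANCE; the randomness is the bath noise).
The stub's object `B_N = varianceChannel = powerCov - commonPast` is DEFINED as a difference of two covariances;
this file proves the fixed-`N` structure behind its name ("conditional-variance channel"), at every real `t`:

* `varianceTransport_fcast_sq_le` — the carrier is non-negative: `v_t(z)² ≤ (K_t p_N²)(z)`, i.e. `w_t ≥ 0`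
  (Jensen for the Markov kernel `K_t(z, ·)`);
* `varianceTransport_integral_condVar` — its Gibbs mean is the lost forecast norm:
  `∫ w_t dμ₀ = T - S_N(t)` (Gibbs invariance of `K_t` and equipartition `∫ p_N² dμ₀ = T`);
* `varianceTransport_eq_integral_condVar` (registered) — **`B_N(t) = ∫ (p₀² - T) · w_t dμ₀ = Cov_{μ₀}(p₀², Var(p_N(t) | z))`**:
  the channel is the response of the far forecast variance to the initial LEFT kinetic temperature excess.

Purely fixed-`N`; no transport content, no definitions. Inputs: `IncoherentBounded.integrable_mul_act`,
`SubdiffusiveBondHeat.pinnedChain_integral_sq_act_le`, `IncoherentBounded.mean_act_sq_momentum`,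
`IncoherentBounded.integral_momentum_sq_gibbsMeasure`.
-/

noncomputable section

namespace Summit.AtomisticToContinuum.FouriersLaw.Theorems.PhononMeanFreePath

open MeasureTheory ProbabilityTheory Set Filter Topology
open scoped NNReal ENNReal
open Literature.MathematicalPhysics.KineticTheory.HeatConduction
open Literature.MathematicalPhysics.KineticTheory Literature.Probability.Process OscillatorChain
open Summit.AtomisticToContinuum.FouriersLaw.Theorems.SubdiffusiveBondHeat
open Summit.AtomisticToContinuum.FouriersLaw.Theorems.IncoherentBounded

section FixedN

variable {ω₂ lam β γ T : ℝ}

/-- **The forecast variance is non-negative** (`w_t = K_t p_N² - (K_t p_N)² ≥ 0`): for every `z` and every real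
`t`, `v_t(z)² ≤ (K_{t⁺} p_N²)(z)` — Jensen's inequality for the probability measure `K_{t⁺}(z, ·)`, under which
`p_N` and `p_N²` are integrable (CEHR (3.4)). [folklore] -/
theorem varianceTransport_fcast_sq_le (hω : 0 < ω₂) (hl : 0 ≤ lam) (hβ : 0 ≤ β) (hγ : 0 ≤ γ) (hT : 0 < T)
    (N : ℕ) (t : ℝ) (z : PhaseSpace (N + 1)) :
    (fcast ω₂ lam β γ T N t z) ^ 2 ≤
      ∫ y, (y.2 (Fin.last N)) ^ 2 ∂((pinnedChain ω₂ lam β γ).transitionKernel (N + 1) T T t.toNNReal z) := by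
  set κ := (pinnedChain ω₂ lam β γ).transitionKernel (N + 1) T T t.toNNReal with hκ
  haveI : IsMarkovKernel κ := pinnedChain_isMarkovKernel_transitionKernel hω hl hβ hγ (N + 1) T T _
  have hϑ0 : (0 : ℝ) < 1 / (4 * T) := by positivity
  have hϑ1 : 1 / (4 * T) < 1 / T := by
    rw [div_lt_div_iff₀ (by positivity) hT]; nlinarith
  have hE := pinnedChain_integrable_exp_mul_hamiltonian_transitionKernel hω hl hT hβ hγ (Nat.succ_pos N)
    hϑ0 hϑ1 t.toNNReal z
  have h1 : Integrable (fun y : PhaseSpace (N + 1) => y.2 (Fin.last N)) (κ z) :=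
    integrable_of_abs_le_exp hE (by fun_prop) (fun y => abs_momentum_le_exp hω hl hβ hϑ0 y (Fin.last N))
  have h2 : Integrable (fun y : PhaseSpace (N + 1) => y.2 (Fin.last N) ^ 2) (κ z) :=
    integrable_of_abs_le_exp hE (by fun_prop) (fun y => by
      rw [abs_of_nonneg (sq_nonneg _)]; exact sq_momentum_le_exp hω hl hβ hϑ0 y (Fin.last N))
  set v : ℝ := fcast ω₂ lam β γ T N t z with hv
  have hv' : (∫ y, y.2 (Fin.last N) ∂(κ z)) = v := rfl
  have hvar : 0 ≤ ∫ y, (y.2 (Fin.last N) - v) ^ 2 ∂(κ z) := integral_nonneg fun y => sq_nonneg _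
  have hexp : ∫ y, (y.2 (Fin.last N) - v) ^ 2 ∂(κ z) = (∫ y, y.2 (Fin.last N) ^ 2 ∂(κ z)) - v ^ 2 := by
    have e : (fun y : PhaseSpace (N + 1) => (y.2 (Fin.last N) - v) ^ 2) =
        fun y => y.2 (Fin.last N) ^ 2 - (2 * v) * y.2 (Fin.last N) + v ^ 2 := by
      funext y; ring
    have i1 : Integrable (fun y : PhaseSpace (N + 1) => y.2 (Fin.last N) ^ 2 - 2 * v * y.2 (Fin.last N)) (κ z) :=
      h2.sub (h1.const_mul _)
    rw [e, integral_add i1 (integrable_const _), integral_sub h2 (h1.const_mul _), integral_const_mul,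
      integral_const, hv']
    simp only [probReal_univ, smul_eq_mul, one_mul]
    ring
  linarith

/-- **The Gibbs mean of the forecast variance is the lost forecast norm**: for every real `t`,
`∫ (K_t p_N² - v_t²) dμ₀ = T - S_N(t)` — Gibbs invariance of the constructed kernels
(`∫ K_t p_N² dμ₀ = ∫ p_N² dμ₀`) and equipartition `∫ p_N² dμ₀ = T`. In particular `0 ≤ S_N(t) ≤ T` is the
law of total variance for `p_N(t)`. [cite: CuneoEckmannHairerReyBellet2018, §3.1] -/
theorem varianceTransport_integral_condVar (hω : 0 < ω₂) (hl : 0 ≤ lam) (hβ : 0 < β) (hγ : 0 < γ) (hT : 0 < T)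
    (N : ℕ) (t : ℝ) :
    ∫ z, ((∫ y, (y.2 (Fin.last N)) ^ 2 ∂((pinnedChain ω₂ lam β γ).transitionKernel (N + 1) T T t.toNNReal z)) -
        (fcast ω₂ lam β γ T N t z) ^ 2) ∂((pinnedChain ω₂ lam β γ).gibbsMeasure (N + 1) T) =
      T - fnorm ω₂ lam β γ T N t := by
  have hϑ0 : (0 : ℝ) < 1 / (4 * T) := by positivity
  have h2ϑ : 2 * (1 / (4 * T)) < 1 / T := by
    rw [show 2 * (1 / (4 * T)) = 1 / (2 * T) by field_simp; ring, div_lt_div_iff₀ (by positivity) hT]; nlinarith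
  have hsqb : ∀ y : PhaseSpace (N + 1), |y.2 (Fin.last N) ^ 2| ≤ (2 / (1 / (4 * T))) *
      Real.exp (1 / (4 * T) * (pinnedChain ω₂ lam β γ).hamiltonian (N + 1) y) := fun y => by
    rw [abs_of_nonneg (sq_nonneg _)]; exact sq_momentum_le_exp (γ := γ) hω hl hβ.le hϑ0 y (Fin.last N)
  have h1G : Integrable (fun z => (1 : ℝ) *
      ∫ y, y.2 (Fin.last N) ^ 2 ∂((pinnedChain ω₂ lam β γ).transitionKernel (N + 1) T T t.toNNReal z))
      ((pinnedChain ω₂ lam β γ).gibbsMeasure (N + 1) T) :=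
    integrable_mul_act hω hl hβ hγ hT (f := fun _ => (1 : ℝ)) continuous_const (by fun_prop) (A := 1)
      (fun y => by
        rw [abs_one, one_mul]
        exact Real.one_le_exp (mul_nonneg hϑ0.le (pinnedChain_hamiltonian_nonneg hω.le hl hβ.le γ (N + 1) y)))
      hsqb _
  have hGi : Integrable (fun z =>
      ∫ y, y.2 (Fin.last N) ^ 2 ∂((pinnedChain ω₂ lam β γ).transitionKernel (N + 1) T T t.toNNReal z))
      ((pinnedChain ω₂ lam β γ).gibbsMeasure (N + 1) T) := by simpa using h1G
  obtain ⟨-, hv2, -⟩ := pinnedChain_integral_sq_act_le hω hl hβ hγ (Nat.succ_pos N) hT hϑ0 h2ϑ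
    (f := fun z : PhaseSpace (N + 1) => z.2 (Fin.last N)) (by fun_prop)
    (fun y => abs_momentum_le_exp hω hl hβ.le hϑ0 y (Fin.last N)) t.toNNReal
  have e : (∫ z, ((∫ y, (y.2 (Fin.last N)) ^ 2
        ∂((pinnedChain ω₂ lam β γ).transitionKernel (N + 1) T T t.toNNReal z)) -
          (fcast ω₂ lam β γ T N t z) ^ 2) ∂((pinnedChain ω₂ lam β γ).gibbsMeasure (N + 1) T)) =
      (∫ z, (∫ y, (y.2 (Fin.last N)) ^ 2 ∂((pinnedChain ω₂ lam β γ).transitionKernel (N + 1) T T t.toNNReal z))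
          ∂((pinnedChain ω₂ lam β γ).gibbsMeasure (N + 1) T)) -
        ∫ z, (fcast ω₂ lam β γ T N t z) ^ 2 ∂((pinnedChain ω₂ lam β γ).gibbsMeasure (N + 1) T) :=
    integral_sub hGi hv2
  rw [e, mean_act_sq_momentum hω hl hβ hγ hT N (Fin.last N) t,
    integral_momentum_sq_gibbsMeasure (γ := γ) hω hl hβ hT (N + 1) (Fin.last N)]
  rfl

end FixedN

/-- **The variance channel in variance clothing: `B_N(t) = ∫ (p₀² - T) · Var(p_N(t) | z) dμ₀(z)`.** For all
parameters `> 0`, `T > 0`, every `N` and every real `t`, the stub's object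
`B_N(t) = varianceChannel … N t = C_N(t) - P_N(t)` (difference of the power covariance `Cov_{μ₀}(p₀², K_t p_N²)`
and the common-past part `Cov_{μ₀}(p₀², v_t²)`) equals the single Gibbs integral
`∫ (p₀² - T)(z) · w_t(z) dμ₀(z)` with the NON-NEGATIVE carrier `w_t = K_t p_N² - v_t² = Var(p_N(t) | z)`
(`varianceTransport_fcast_sq_le`), i.e. `B_N(t) = Cov_{μ₀}(p₀², Var(p_N(t) | z))` since `∫ p₀² dμ₀ = T`:
the covariance of the initial left kinetic energy with the forecast VARIANCE of the far momentum. Bilinearity of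
the covariance, with every term `μ₀`-integrable at fixed `N` (Jensen + Gibbs invariance). Registered helper for
`stub_varianceTransport` (line `two-horizons-forecast-loss`); fixed-`N` structure only. [folklore] -/
theorem varianceTransport_eq_integral_condVar : ∀ ω₂ lam β γ : ℝ, 0 < ω₂ → 0 < lam → 0 < β → 0 < γ → ∀ T : ℝ, 0 < T → ∀ (N : ℕ) (t : ℝ), varianceChannel ω₂ lam β γ T N t = ∫ z, ((z.2 0) ^ 2 - T) * ((∫ y, (y.2 (Fin.last N)) ^ 2 ∂((pinnedChain ω₂ lam β γ).transitionKernel (N + 1) T T t.toNNReal z)) - (fcast ω₂ lam β γ T N t z) ^ 2) ∂((pinnedChain ω₂ lam β γ).gibbsMeasure (N + 1) T) := by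
  intro ω₂ lam β γ hω hl' hβ hγ T hT N t
  have hl : 0 ≤ lam := hl'.le
  set P := pinnedChain ω₂ lam β γ with hP
  set μ := P.gibbsMeasure (N + 1) T with hμ
  set κ := P.transitionKernel (N + 1) T T t.toNNReal with hκ
  haveI : IsProbabilityMeasure μ := pinnedChain_isProbabilityMeasure_gibbsMeasure hω hl hβ.le γ (N + 1) hT
  have hϑ0 : (0 : ℝ) < 1 / (4 * T) := by positivity
  have h2ϑ : 2 * (1 / (4 * T)) < 1 / T := by
    rw [show 2 * (1 / (4 * T)) = 1 / (2 * T) by field_simp; ring, div_lt_div_iff₀ (by positivity) hT]; nlinarith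
  have hsqb : ∀ (j : Fin (N + 1)) (y : PhaseSpace (N + 1)), |y.2 j ^ 2| ≤ (2 / (1 / (4 * T))) *
      Real.exp (1 / (4 * T) * P.hamiltonian (N + 1) y) := fun j y => by
    rw [abs_of_nonneg (sq_nonneg _)]; exact sq_momentum_le_exp (γ := γ) hω hl hβ.le hϑ0 y j
  -- the two kernel observables `G = K_t p_N²`, `v = K_t p_N`
  set G : PhaseSpace (N + 1) → ℝ := fun z => ∫ y, y.2 (Fin.last N) ^ 2 ∂(κ z) with hG
  set v : PhaseSpace (N + 1) → ℝ := fun z => fcast ω₂ lam β γ T N t z with hv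
  have hvsm : StronglyMeasurable v :=
    (by fun_prop : Continuous fun y : PhaseSpace (N + 1) => y.2 (Fin.last N)).stronglyMeasurable.integral_kernel
      (κ := κ)
  -- integrability of every term
  have hpG : Integrable (fun z => z.2 0 ^ 2 * G z) μ :=
    integrable_mul_act hω hl hβ hγ hT (by fun_prop) (by fun_prop) (hsqb 0) (hsqb (Fin.last N)) _
  have h1G : Integrable (fun z => (1 : ℝ) * G z) μ :=
    integrable_mul_act hω hl hβ hγ hT (f := fun _ => (1 : ℝ)) continuous_const (by fun_prop) (A := 1)
      (fun y => by
        rw [abs_one, one_mul]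
        exact Real.one_le_exp (mul_nonneg hϑ0.le (pinnedChain_hamiltonian_nonneg hω.le hl hβ.le γ (N + 1) y)))
      (hsqb (Fin.last N)) _
  have hGi : Integrable G μ := by simpa using h1G
  obtain ⟨-, hv2, -⟩ := pinnedChain_integral_sq_act_le hω hl hβ hγ (Nat.succ_pos N) hT hϑ0 h2ϑ
    (f := fun z : PhaseSpace (N + 1) => z.2 (Fin.last N)) (by fun_prop)
    (fun y => abs_momentum_le_exp hω hl hβ.le hϑ0 y (Fin.last N)) t.toNNReal
  have hv2' : Integrable (fun z => v z ^ 2) μ := hv2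
  have hjensen : ∀ z, v z ^ 2 ≤ G z := fun z =>
    varianceTransport_fcast_sq_le hω hl hβ.le hγ.le hT N t z
  have hq : Measurable fun z : PhaseSpace (N + 1) => z.2 0 ^ 2 :=
    (by fun_prop : Continuous fun z : PhaseSpace (N + 1) => z.2 0 ^ 2).measurable
  have hpv2 : Integrable (fun z => z.2 0 ^ 2 * v z ^ 2) μ :=
    hpG.mono' (hq.mul (hvsm.measurable.pow_const 2)).aestronglyMeasurable (Eventually.of_forall fun z => by
      rw [Real.norm_eq_abs, abs_of_nonneg (mul_nonneg (sq_nonneg _) (sq_nonneg _))]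
      exact mul_le_mul_of_nonneg_left (hjensen z) (sq_nonneg _))
  have hm0 : ∫ z, z.2 0 ^ 2 ∂μ = T := integral_momentum_sq_gibbsMeasure (γ := γ) hω hl hβ hT (N + 1) 0
  -- bilinearity
  have lhs : varianceChannel ω₂ lam β γ T N t =
      ((∫ z, z.2 0 ^ 2 * G z ∂μ) - (∫ z, z.2 0 ^ 2 ∂μ) * ∫ z, G z ∂μ) -
        ((∫ z, z.2 0 ^ 2 * v z ^ 2 ∂μ) - (∫ z, z.2 0 ^ 2 ∂μ) * ∫ z, v z ^ 2 ∂μ) := rfl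
  have hexp : (fun z => (z.2 0 ^ 2 - T) * (G z - v z ^ 2)) =
      fun z => z.2 0 ^ 2 * G z - z.2 0 ^ 2 * v z ^ 2 - T * G z + T * v z ^ 2 := by
    funext z; ring
  have i2 : Integrable (fun z => z.2 0 ^ 2 * G z - z.2 0 ^ 2 * v z ^ 2) μ := hpG.sub hpv2
  have i3 : Integrable (fun z => z.2 0 ^ 2 * G z - z.2 0 ^ 2 * v z ^ 2 - T * G z) μ := i2.sub (hGi.const_mul T)
  rw [lhs, hm0]
  show _ = ∫ z, (z.2 0 ^ 2 - T) * (G z - v z ^ 2) ∂μ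
  rw [hexp, integral_add i3 (hv2'.const_mul T), integral_sub i2 (hGi.const_mul T), integral_sub hpG hpv2,
    integral_const_mul, integral_const_mul]
  ring

end Summit.AtomisticToContinuum.FouriersLaw.Theorems.PhononMeanFreePath

end
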